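import Summits.Ventures.PercRepro.StarGadgetPurePairG

/-!
# `G ≥ 0` at `s = 0, p = 0, n = 0` (node n4: half-spaces `q ≥ 1`, `r ≥ 1` and the origin)

One module of the exact certificate tree for `G` (data/mine-3/g20/single-p2.json, key `P[xc|xc]|cx=1`; one lemma per node:
half-space domination certificates, finite boxes, case splits `x = 0 / x ≥ 1`). The definition of `G` is in `StarGadgetPurePairG`;
the theorem `G_nonneg` is in `StarGadgetPurePairNonneg`. A factor `(0:ℤ)^x` is the indicator `[x = 0]`.
-/

namespace PercRepro.StarGadget

/-- Half-space lemma of node n4 of the certificate tree (parent `G_n4`: `0 ≤ G 0 q r 0 0`), direction `q` (the half-space `q ≥ 1` of the parent's variable): `0 ≤ G 0 (q + 1) r 0 0` — the exact domination certificate of record (data/mine-3/g20/single-p2.json, key `P[xc|xc]|cx=1`, node n4, direction q, N = 1): coordinatewise base monotonicity of the dominated monomials, positivity, `linarith`. -/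
theorem G_n4_dq (q r : ℕ) : 0 ≤ G 0 (q + 1) r 0 0 := by
  have h0 : (4:ℤ)^q * 4^r ≤ (5:ℤ)^q * 5^r := by
    have := show (4:ℤ)^q * 4^r ≤ (5:ℤ)^q * 5^r by
      gcongr
      all_goals norm_num
    simpa using this
  have h1 : (4:ℤ)^q * 4^r ≤ (5:ℤ)^q * 4^r := by
    have := show (4:ℤ)^q * 4^r ≤ (5:ℤ)^q * 4^r by
      gcongr
      all_goals norm_num
    simpa using this
  have h2 : (4:ℤ)^q * 4^r ≤ (4:ℤ)^q * 5^r := by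
    have := show (4:ℤ)^q * 4^r ≤ (4:ℤ)^q * 5^r by
      gcongr
      all_goals norm_num
    simpa using this
  have h3 : (2:ℤ)^q ≤ (4:ℤ)^q := by
    have := show (2:ℤ)^q * 1^r ≤ (4:ℤ)^q * 1^r by
      gcongr
      all_goals norm_num
    simpa using this
  have h4 : (2:ℤ)^q ≤ (2:ℤ)^q * 5^r := by
    have := show (2:ℤ)^q * 1^r ≤ (2:ℤ)^q * 5^r by
      gcongr
      all_goals norm_num
    simpa using this
  have h5 : (2:ℤ)^r ≤ (4:ℤ)^r := by
    have := show (1:ℤ)^q * 2^r ≤ (1:ℤ)^q * 4^r by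
      gcongr
      all_goals norm_num
    simpa using this
  have h6 : (2:ℤ)^r ≤ (2:ℤ)^q * 5^r := by
    have := show (1:ℤ)^q * 2^r ≤ (2:ℤ)^q * 5^r by
      gcongr
      all_goals norm_num
    simpa using this
  have h7 : (2:ℤ)^q * 2^r ≤ (5:ℤ)^q * 2^r := by
    have := show (2:ℤ)^q * 2^r ≤ (5:ℤ)^q * 2^r by
      gcongr
      all_goals norm_num
    simpa using this
  have h8 : (2:ℤ)^q * 2^r ≤ (2:ℤ)^q * 5^r := by
    have := show (2:ℤ)^q * 2^r ≤ (2:ℤ)^q * 5^r by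
      gcongr
      all_goals norm_num
    simpa using this
  have h9 : (2:ℤ)^q * 4^r ≤ (5:ℤ)^q * 4^r := by
    have := show (2:ℤ)^q * 4^r ≤ (5:ℤ)^q * 4^r by
      gcongr
      all_goals norm_num
    simpa using this
  have h10 : (2:ℤ)^q * 4^r ≤ (3:ℤ)^q * 4^r := by
    have := show (2:ℤ)^q * 4^r ≤ (3:ℤ)^q * 4^r by
      gcongr
      all_goals norm_num
    simpa using this
  have h11 : (4:ℤ)^q * 2^r ≤ (5:ℤ)^q * 5^r := by
    have := show (4:ℤ)^q * 2^r ≤ (5:ℤ)^q * 5^r by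
      gcongr
      all_goals norm_num
    simpa using this
  have h12 : (4:ℤ)^q * 2^r ≤ (4:ℤ)^q * 3^r := by
    have := show (4:ℤ)^q * 2^r ≤ (4:ℤ)^q * 3^r by
      gcongr
      all_goals norm_num
    simpa using this
  have h13 : (4:ℤ)^q * 2^r ≤ (5:ℤ)^q * 2^r := by
    have := show (4:ℤ)^q * 2^r ≤ (5:ℤ)^q * 2^r by
      gcongr
      all_goals norm_num
    simpa using this
  have h14 : (5:ℤ)^q * 3^r ≤ (5:ℤ)^q * 5^r := by
    have := show (5:ℤ)^q * 3^r ≤ (5:ℤ)^q * 5^r by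
      gcongr
      all_goals norm_num
    simpa using this
  have h15 : (3:ℤ)^q * 5^r ≤ (5:ℤ)^q * 5^r := by
    have := show (3:ℤ)^q * 5^r ≤ (5:ℤ)^q * 5^r by
      gcongr
      all_goals norm_num
    simpa using this
  have h16 : (0:ℤ) ≤ (1:ℤ) := by positivity
  have h17 : (0:ℤ) ≤ (4:ℤ)^q := by positivity
  have h18 : (0:ℤ) ≤ (4:ℤ)^r := by positivity
  have h19 : (0:ℤ) ≤ (5:ℤ)^q * 5^r := by positivity
  have h20 : (0:ℤ) ≤ (4:ℤ)^q * 3^r := by positivity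
  have h21 : (0:ℤ) ≤ (5:ℤ)^q * 2^r := by positivity
  have h22 : (0:ℤ) ≤ (5:ℤ)^q * 4^r := by positivity
  have h23 : (0:ℤ) ≤ (3:ℤ)^q * 4^r := by positivity
  have h24 : (0:ℤ) ≤ (2:ℤ)^q * 5^r := by positivity
  have h25 : (0:ℤ) ≤ (4:ℤ)^q * 5^r := by positivity
  unfold G
  simp only [pow_add]
  norm_num
  linarith [h0, h1, h2, h3, h4, h5, h6, h7, h8, h9, h10, h11, h12, h13, h14, h15, h16, h17, h18, h19, h20, h21, h22, h23, h24, h25]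

/-- Half-space lemma of node n4 of the certificate tree (parent `G_n4`: `0 ≤ G 0 q r 0 0`), direction `r` (the half-space `r ≥ 1` of the parent's variable): `0 ≤ G 0 q (r + 1) 0 0` — the exact domination certificate of record (data/mine-3/g20/single-p2.json, key `P[xc|xc]|cx=1`, node n4, direction r, N = 1): coordinatewise base monotonicity of the dominated monomials, positivity, `linarith`. -/
theorem G_n4_dr (q r : ℕ) : 0 ≤ G 0 q (r + 1) 0 0 := by
  have h0 : (4:ℤ)^q * 4^r ≤ (5:ℤ)^q * 4^r := by
    have := show (4:ℤ)^q * 4^r ≤ (5:ℤ)^q * 4^r by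
      gcongr
      all_goals norm_num
    simpa using this
  have h1 : (4:ℤ)^q * 4^r ≤ (4:ℤ)^q * 5^r := by
    have := show (4:ℤ)^q * 4^r ≤ (4:ℤ)^q * 5^r by
      gcongr
      all_goals norm_num
    simpa using this
  have h2 : (2:ℤ)^q ≤ (4:ℤ)^q := by
    have := show (2:ℤ)^q * 1^r ≤ (4:ℤ)^q * 1^r by
      gcongr
      all_goals norm_num
    simpa using this
  have h3 : (2:ℤ)^q ≤ (5:ℤ)^q * 4^r := by
    have := show (2:ℤ)^q * 1^r ≤ (5:ℤ)^q * 4^r by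
      gcongr
      all_goals norm_num
    simpa using this
  have h4 : (2:ℤ)^q ≤ (3:ℤ)^q * 4^r := by
    have := show (2:ℤ)^q * 1^r ≤ (3:ℤ)^q * 4^r by
      gcongr
      all_goals norm_num
    simpa using this
  have h5 : (2:ℤ)^r ≤ (4:ℤ)^r := by
    have := show (1:ℤ)^q * 2^r ≤ (1:ℤ)^q * 4^r by
      gcongr
      all_goals norm_num
    simpa using this
  have h6 : (2:ℤ)^r ≤ (5:ℤ)^q * 5^r := by
    have := show (1:ℤ)^q * 2^r ≤ (5:ℤ)^q * 5^r by
      gcongr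
      all_goals norm_num
    simpa using this
  have h7 : (2:ℤ)^q * 2^r ≤ (4:ℤ)^q * 3^r := by
    have := show (2:ℤ)^q * 2^r ≤ (4:ℤ)^q * 3^r by
      gcongr
      all_goals norm_num
    simpa using this
  have h8 : (2:ℤ)^q * 2^r ≤ (5:ℤ)^q * 2^r := by
    have := show (2:ℤ)^q * 2^r ≤ (5:ℤ)^q * 2^r by
      gcongr
      all_goals norm_num
    simpa using this
  have h9 : (2:ℤ)^q * 4^r ≤ (3:ℤ)^q * 4^r := by
    have := show (2:ℤ)^q * 4^r ≤ (3:ℤ)^q * 4^r by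
      gcongr
      all_goals norm_num
    simpa using this
  have h10 : (2:ℤ)^q * 4^r ≤ (2:ℤ)^q * 5^r := by
    have := show (2:ℤ)^q * 4^r ≤ (2:ℤ)^q * 5^r by
      gcongr
      all_goals norm_num
    simpa using this
  have h11 : (4:ℤ)^q * 2^r ≤ (5:ℤ)^q * 5^r := by
    have := show (4:ℤ)^q * 2^r ≤ (5:ℤ)^q * 5^r by
      gcongr
      all_goals norm_num
    simpa using this
  have h12 : (4:ℤ)^q * 2^r ≤ (4:ℤ)^q * 3^r := by
    have := show (4:ℤ)^q * 2^r ≤ (4:ℤ)^q * 3^r by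
      gcongr
      all_goals norm_num
    simpa using this
  have h13 : (5:ℤ)^q * 3^r ≤ (5:ℤ)^q * 5^r := by
    have := show (5:ℤ)^q * 3^r ≤ (5:ℤ)^q * 5^r by
      gcongr
      all_goals norm_num
    simpa using this
  have h14 : (3:ℤ)^q * 5^r ≤ (5:ℤ)^q * 5^r := by
    have := show (3:ℤ)^q * 5^r ≤ (5:ℤ)^q * 5^r by
      gcongr
      all_goals norm_num
    simpa using this
  have h15 : (0:ℤ) ≤ (1:ℤ) := by positivity
  have h16 : (0:ℤ) ≤ (4:ℤ)^q := by positivity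
  have h17 : (0:ℤ) ≤ (4:ℤ)^r := by positivity
  have h18 : (0:ℤ) ≤ (5:ℤ)^q * 5^r := by positivity
  have h19 : (0:ℤ) ≤ (4:ℤ)^q * 3^r := by positivity
  have h20 : (0:ℤ) ≤ (5:ℤ)^q * 2^r := by positivity
  have h21 : (0:ℤ) ≤ (5:ℤ)^q * 4^r := by positivity
  have h22 : (0:ℤ) ≤ (3:ℤ)^q * 4^r := by positivity
  have h23 : (0:ℤ) ≤ (2:ℤ)^q * 5^r := by positivity
  have h24 : (0:ℤ) ≤ (4:ℤ)^q * 5^r := by positivity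
  unfold G
  simp only [pow_add]
  norm_num
  linarith [h0, h1, h2, h3, h4, h5, h6, h7, h8, h9, h10, h11, h12, h13, h14, h15, h16, h17, h18, h19, h20, h21, h22, h23, h24]

/-- Node n4 of the certificate tree (half-space node): `0 ≤ G 0 q r 0 0` — the half-spaces `q ≥ 1`, `r ≥ 1` (direction lemmas `G_n4_d*`) and the remaining single point by `norm_num [G]`. -/
theorem G_n4 (q r : ℕ) : 0 ≤ G 0 q r 0 0 := by
  by_cases hq : 1 ≤ q
  · obtain ⟨q, rfl⟩ := Nat.exists_eq_add_of_le' hq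
    exact G_n4_dq q r
  by_cases hr : 1 ≤ r
  · obtain ⟨r, rfl⟩ := Nat.exists_eq_add_of_le' hr
    exact G_n4_dr q r
  push Not at hq hr
  obtain rfl : q = 0 := by omega
  obtain rfl : r = 0 := by omega
  norm_num [G]

end PercRepro.StarGadget
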